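import Summits.Langlands.Langlands.Theses.RamifiedCoefficientSeed
import Summits.Langlands.Langlands.Theses.PrimeSwitchSplit
import HarnessLib

/-!
# Birth skeleton (BC3) for the split child `SatakeAvatarExistence` of `RamifiedCoefficientSeed.SectorComplement`
(crux-strategist cstrat-stmt-Langlands-16781-r1, 2026-08-17; child item: stmt-Langlands-17415 (verbatim; attached child of 16781))

W⁺ = an IRREDUCIBLE Satake avatar of every L-algebraic cuspidal `π`.  Split EXISTENCE / IRREDUCIBILITY (route PrimeSwitchSplit's
foreseen layer-2 split of this very item, "W⁺ ⇐ SemisimpleAvatar → CuspidalAvatarIrreducible"): a SEMISIMPLE avatar exists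
(Buzzard–Gee Conj. 3.2.2 weak form — a theorem for regular algebraic `π` over CM / totally real `K`, HLTT 2016 Thm. A / Scholze
2015 V.4.2; open for irregular `π` and general `K`), and every semisimple avatar of a CUSPIDAL `π` is irreducible
(Ramakrishnan's conjecture; in tree derivable from (B)-weak below the rank + Jacquet–Shalika, `isIrreducible_of_weakAutomorphy_allRanks`).

BY-NAME VERSION: the child item is SHARED — it is stmt-level identical to `Summit.Langlands.Langlands.Theses.PrimeSwitchSplit.SatakeAvatarExistence`
(an existing decl), so this skeleton concludes THAT decl by name (`open … PrimeSwitchSplit (SatakeAvatarExistence)`); after `route edit --split` the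
homonymous `RamifiedCoefficientSeed.SatakeAvatarExistence` is definitionally the same term.  Register with
`ledger skeleton check <this file> --crux <child item> --crux-decl Summit.Langlands.Langlands.Theses.PrimeSwitchSplit.SatakeAvatarExistence`.
`lean check`: rc 0, sorries = the `stub_*` only; `SatakeAvatarExistence_of` concludes the child BY NAME.
-/

noncomputable section

set_option linter.dupNamespace false

namespace Summit.Langlands.Langlands.Cruxes.SectorComplement.BirthSatakeAvatarExistence

open scoped NumberField Classical Topology
open Filter IsDedekindDomain
open Literature.NumberTheory.Automorphic Literature.NumberTheory.GaloisRepresentations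
open Summit.Langlands

open Summit.Langlands.Langlands.Theses.PrimeSwitchSplit (SatakeAvatarExistence)

/-- **stub SEMISIMPLE AVATAR** — every L-algebraic cuspidal `π` of `GL_n(𝔸_K)` has, for all `ℓ, ι`, a SEMISIMPLE
`ρ : Γ_K → GL_n(ℚ̄_ℓ)` Satake–Frobenius compatible with `(π, ι)` a.e. (Buzzard–Gee Conj. 3.2.2, weak form; semisimplicity is
free by semisimplification).  THEOREM for regular algebraic `π` over CM / totally real `K` (Harris–Lan–Taylor–Thorne 2016
Thm. A; Scholze 2015 Cor. V.4.2); OPEN for irregular `π` (NonRegularWeightBarrier) and general `K`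
(ShimuraVarietyRealizationBarrier).  Size open-problem.
[cite: BuzzardGeeLMS2014, Conj. 3.2.2] [cite: HarrisLanTaylorThorneRMS2016, Thm. A] [cite: Scholze2015, Cor. V.4.2] -/
theorem stub_semisimpleAvatar : ∀ (K : Type) [Field K] [NumberField K] (n : ℕ) (hcpt : Literature.NumberTheory.Automorphic.isCompact_glFiniteIntegralLevel n K), 0 < n → ∀ (π : Literature.NumberTheory.Automorphic.CuspidalAutomorphicRepData n K hcpt), π.1.IsLAlgebraic → ∀ (ℓ : ℕ) [Fact ℓ.Prime] (ι : PadicAlgCl ℓ ≃+* ℂ), ∃ ρ : Literature.NumberTheory.GaloisRepresentations.FramedGaloisRep K (PadicAlgCl ℓ) n, ρ.toGaloisRep.IsSemisimple ∧ ∀ᶠ v : IsDedekindDomain.HeightOneSpectrum (NumberField.RingOfIntegers K) in cofinite, SatakeFrobCompatibleAt ι π.1 ρ v := by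
  sorry

/-- **stub CUSPIDAL ⇒ IRREDUCIBLE** — a semisimple `ℓ`-adic representation Satake–Frobenius compatible a.e. with a CUSPIDAL
L-algebraic `π` is irreducible (Ramakrishnan; known for `n ≤ 3` in print — Ribet `n = 2`, Blasius–Rogawski / Ramakrishnan
`n = 3` — and for regular polarised `π` at density-one `ι`, Patrikis–Taylor; in tree it follows from (B)-weak strictly below
the rank + Jacquet–Shalika (2.2)–(2.3) by the isobaric bootstrap `isIrreducible_of_weakAutomorphy_allRanks`).  Why it might
fail: it is open for `n ≥ 4` in general.  Size L–open-problem.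
[cite: PatrikisTaylor2014, Thm. A] [cite: CalegariGee2013, §1.1] -/
theorem stub_cuspidalAvatarIrreducible : ∀ (K : Type) [Field K] [NumberField K] (n : ℕ) (hcpt : Literature.NumberTheory.Automorphic.isCompact_glFiniteIntegralLevel n K), 0 < n → ∀ (π : Literature.NumberTheory.Automorphic.CuspidalAutomorphicRepData n K hcpt), π.1.IsLAlgebraic → ∀ (ℓ : ℕ) [Fact ℓ.Prime] (ι : PadicAlgCl ℓ ≃+* ℂ) (ρ : Literature.NumberTheory.GaloisRepresentations.FramedGaloisRep K (PadicAlgCl ℓ) n), ρ.toGaloisRep.IsSemisimple → (∀ᶠ v : IsDedekindDomain.HeightOneSpectrum (NumberField.RingOfIntegers K) in cofinite, SatakeFrobCompatibleAt ι π.1 ρ v) → ρ.toGaloisRep.IsIrreducible := by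
  sorry

namespace _Goal

/-- The statement of `stub_semisimpleAvatar` (literally its type). [folklore] -/
def stub_semisimpleAvatar : Prop :=
  type_of% @Summit.Langlands.Langlands.Cruxes.SectorComplement.BirthSatakeAvatarExistence.stub_semisimpleAvatar

/-- The statement of `stub_cuspidalAvatarIrreducible` (literally its type). [folklore] -/
def stub_cuspidalAvatarIrreducible : Prop :=
  type_of% @Summit.Langlands.Langlands.Cruxes.SectorComplement.BirthSatakeAvatarExistence.stub_cuspidalAvatarIrreducible

end _Goal

/-- **W⁺ from its two stubs.** -/
theorem SatakeAvatarExistence_of (h1 : _Goal.stub_semisimpleAvatar) (h2 : _Goal.stub_cuspidalAvatarIrreducible) : SatakeAvatarExistence := by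
  dsimp only [_Goal.stub_semisimpleAvatar, _Goal.stub_cuspidalAvatarIrreducible] at h1 h2
  intro K _ _ n hcpt hn π hL ℓ _ ι
  obtain ⟨ρ, hss, hρ⟩ := h1 K n hcpt hn π hL ℓ ι
  exact ⟨ρ, h2 K n hcpt hn π hL ℓ ι ρ hss hρ, hρ⟩

/-- by-name sanity check -/
example : SatakeAvatarExistence := SatakeAvatarExistence_of stub_semisimpleAvatar stub_cuspidalAvatarIrreducible

end Summit.Langlands.Langlands.Cruxes.SectorComplement.BirthSatakeAvatarExistence

end
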